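import Summits.QuantumFields.YangMills.Theorems.FluctuationComparisonRegPrIntLS2BetaCovariantOscillationKUniform
import HarnessLib

/-!
# S2β · (REG-UP)′ — «px13 g29's ✓p840162 `…CovariantOscillationKUniform` §1–§3 WITH 𝔰𝔲(N)-VALUED INPUTS»: the composite map `D` acts on `𝔰𝔲(N)`-valued fine data (where the tree's derivative letters
# ✓p840499 (hD), ✓(hNL closed), ✓(β4) `hDcov_closed` live), the outputs and the conjugations stay matrix-valued; proofs VERBATIM (the algebra never used the input type)

Cell `ym3-torus` (YM ladder rung R3 = continuum `SU(2)` Yang–Mills on the three-torus at fixed lattice data — a RUNG: NOT d = 4, NOT infinite volume, NOT a mass gap,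
NOT Clay).  Width seat «width 12» `ym3-torus-px12` (gen 27); crux `stmt-QuantumFields-20520`, LINE g18-1 S2β, node (REG-UP)′ (the docking adapter named in px12 03:52Z: ✓p840162 takes `D` on
MATRIX-valued inputs; the derivative letters are 𝔰𝔲(N)-input).  `--kind proof --supports stmt-QuantumFields-20520 --as helper`, count-neutral, DEFINITION-FREE (0 `def`, 0 `instance`, 0 `notation`,
0 `sorry`, default heartbeats).  Generic `P : Params`, `SU(N)`; credit px13 g29 (statements and proofs are theirs with one type changed).

WHAT IS PROVED (sorry-free).  `step_of_compositeLetters_lie`, `wordOsc_of_compositeLetters_lie`, `wordOsc_datum_of_compositeLetters_lie`, ★★★**`hOSC_of_compositeLetters_lie`** — ✓p840162's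
four theorems with `D : (PBond P j → 𝔰𝔲(N)) → (PBond P l → Matrix)`, `X₀ Y′ : PBond P j → 𝔰𝔲(N)`, (hD) in the sup form `(∀ b, ‖↑(Y b)‖ ≤ s) → ‖D Y c‖ ≤ Λ·s` (= ✓p840499
`norm_fderiv_chartReadFromAt_apply_le_of_sup`), (hDcov)'s first conjunct `‖↑(Y′ b) − ↑(X₀ b)‖ ≤ ℓ·c₀` (= ✓p840562 `hDcov_of_letters_exists`).

HONEST SCOPE.  A type adapter; nothing of Bałaban's renormalisation-group analysis proved ([Balaban1985Averaging] Prop. 4 (128)–(135) pp.37–38); (REG-UP)′'s instantiation knot, GAP♯∘ (`stub_uniformFibreGapOrbit`,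
registry 3732b7df UNTOUCHED, 0∕5), the five registered stubs, S2β, crux 20520, 19936, 19200, `YM3TorusSU2` — NOT proved; rung R3 — NOT d = 4, NOT infinite volume, NOT a mass gap, NOT Clay;
the Yang–Mills mass gap is NOT proved.
-/

set_option autoImplicit false

noncomputable section

open scoped Matrix.Norms.L2Operator

namespace Summit.QuantumFields.YangMills.Theorems.FluctuationComparisonRegPrIntLS2BetaCovariantOscillationKUniformLie

open Literature.MathematicalPhysics.QuantumFieldTheory.Balaban1983to89
open T4Continuum (walk walkEnd holAt Letter)
open HaarExponentialChart
open T4AxialGaugeSmallField (axialGauge)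
open Summit.QuantumFields.YangMills.Theorems.FluctuationComparisonRegPrIntLS2BetaCovariantOscillationWalkSums (wordOsc_of_step)
open Summit.QuantumFields.YangMills.Theorems.FluctuationComparisonRegPrIntLS2BetaCovariantOscillationFeed (wordOsc_of_approx)
open Summit.QuantumFields.YangMills.Theorems.FluctuationComparisonRegPrIntLS2BetaCovariantOscillationTower (zdWordOsc_of_torusWordOsc)
open Summit.QuantumFields.YangMills.Theorems.FluctuationComparisonRegPrIntLS2BetaCovariantOscillationCornerBox (hOSC_of_wordOscillation)

variable {P : Params} {j l N : ℕ} [NeZero N]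

/-- ★ **ONE COARSE STEP FROM THE COMPOSITE LETTERS, 𝔰𝔲(N)-VALUED INPUTS** (✓p840162 §1 verbatim): `‖↑Ū⟨ȳ,μ⟩·(D X₀)⟨ȳ+e_μ,κ⟩·↑Ū⋆ − (D X₀)⟨ȳ,κ⟩‖ ≤ β + Λ·(ℓ·c₀)`.
[cite: Balaban1985Averaging, Prop. 4 (128)-(131) pp.37-38, (124)-(125) p.36] -/
theorem step_of_compositeLetters_lie (Ubar : GaugeField P l (Matrix.specialUnitaryGroup (Fin N) ℂ))
    (D : (PBond P j → (specialUnitaryLogChart (Fin N)).lie) → (PBond P l → Matrix (Fin N) (Fin N) ℂ)) (X₀ : PBond P j → (specialUnitaryLogChart (Fin N)).lie) {Λ β ℓ c₀ : ℝ}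
    (hDlin : ∀ Y Y' : PBond P j → (specialUnitaryLogChart (Fin N)).lie, D (fun b => Y b - Y' b) = fun c => D Y c - D Y' c)
    (hD : ∀ (Y : PBond P j → (specialUnitaryLogChart (Fin N)).lie) (s : ℝ), (∀ b, ‖((Y b : (specialUnitaryLogChart (Fin N)).lie) : Matrix (Fin N) (Fin N) ℂ)‖ ≤ s) → ∀ c, ‖D Y c‖ ≤ Λ * s)
    (hDcov : ∀ (y : Site P l) (μ : Fin P.d), ∃ Y' : PBond P j → (specialUnitaryLogChart (Fin N)).lie, (∀ b, ‖((Y' b : (specialUnitaryLogChart (Fin N)).lie) : Matrix (Fin N) (Fin N) ℂ) - ((X₀ b : (specialUnitaryLogChart (Fin N)).lie) : Matrix (Fin N) (Fin N) ℂ)‖ ≤ ℓ * c₀) ∧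
      ∀ κ : Fin P.d, ‖((Ubar ⟨y, μ⟩ : Matrix.specialUnitaryGroup (Fin N) ℂ) : Matrix (Fin N) (Fin N) ℂ) * D X₀ ⟨y.shift μ, κ⟩ *
          star ((Ubar ⟨y, μ⟩ : Matrix.specialUnitaryGroup (Fin N) ℂ) : Matrix (Fin N) (Fin N) ℂ) - D Y' ⟨y, κ⟩‖ ≤ β)
    (y : Site P l) (μ κ : Fin P.d) :
    ‖((Ubar ⟨y, μ⟩ : Matrix.specialUnitaryGroup (Fin N) ℂ) : Matrix (Fin N) (Fin N) ℂ) * D X₀ ⟨y.shift μ, κ⟩ *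
        star ((Ubar ⟨y, μ⟩ : Matrix.specialUnitaryGroup (Fin N) ℂ) : Matrix (Fin N) (Fin N) ℂ) - D X₀ ⟨y, κ⟩‖ ≤ β + Λ * (ℓ * c₀) := by
  obtain ⟨Y', hY', hcov⟩ := hDcov y μ
  have hlin : D Y' ⟨y, κ⟩ - D X₀ ⟨y, κ⟩ = D (fun b => Y' b - X₀ b) ⟨y, κ⟩ := by rw [hDlin]
  have hsup : ‖D (fun b => Y' b - X₀ b) ⟨y, κ⟩‖ ≤ Λ * (ℓ * c₀) :=
    hD _ _ (fun b => by rw [Submodule.coe_sub]; exact hY' b) _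
  calc _ = ‖(((Ubar ⟨y, μ⟩ : Matrix.specialUnitaryGroup (Fin N) ℂ) : Matrix (Fin N) (Fin N) ℂ) * D X₀ ⟨y.shift μ, κ⟩ *
            star ((Ubar ⟨y, μ⟩ : Matrix.specialUnitaryGroup (Fin N) ℂ) : Matrix (Fin N) (Fin N) ℂ) - D Y' ⟨y, κ⟩) + (D Y' ⟨y, κ⟩ - D X₀ ⟨y, κ⟩)‖ := by
          congr 1; abel
    _ ≤ β + Λ * (ℓ * c₀) := (norm_add_le _ _).trans (add_le_add (hcov κ) (by rw [hlin]; exact hsup))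

/-- ★★ **THE WORD-OSCILLATION OF THE COMPOSITE IMAGE**, 𝔰𝔲(N)-valued inputs (✓p840162 §2 verbatim). [cite: Balaban1985Averaging, Prop. 4 (128)-(131) pp.37-38] -/
theorem wordOsc_of_compositeLetters_lie (Ubar : GaugeField P l (Matrix.specialUnitaryGroup (Fin N) ℂ))
    (D : (PBond P j → (specialUnitaryLogChart (Fin N)).lie) → (PBond P l → Matrix (Fin N) (Fin N) ℂ)) (X₀ : PBond P j → (specialUnitaryLogChart (Fin N)).lie) {Λ β ℓ c₀ : ℝ}
    (hDlin : ∀ Y Y' : PBond P j → (specialUnitaryLogChart (Fin N)).lie, D (fun b => Y b - Y' b) = fun c => D Y c - D Y' c)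
    (hD : ∀ (Y : PBond P j → (specialUnitaryLogChart (Fin N)).lie) (s : ℝ), (∀ b, ‖((Y b : (specialUnitaryLogChart (Fin N)).lie) : Matrix (Fin N) (Fin N) ℂ)‖ ≤ s) → ∀ c, ‖D Y c‖ ≤ Λ * s)
    (hDcov : ∀ (y : Site P l) (μ : Fin P.d), ∃ Y' : PBond P j → (specialUnitaryLogChart (Fin N)).lie, (∀ b, ‖((Y' b : (specialUnitaryLogChart (Fin N)).lie) : Matrix (Fin N) (Fin N) ℂ) - ((X₀ b : (specialUnitaryLogChart (Fin N)).lie) : Matrix (Fin N) (Fin N) ℂ)‖ ≤ ℓ * c₀) ∧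
      ∀ κ : Fin P.d, ‖((Ubar ⟨y, μ⟩ : Matrix.specialUnitaryGroup (Fin N) ℂ) : Matrix (Fin N) (Fin N) ℂ) * D X₀ ⟨y.shift μ, κ⟩ *
          star ((Ubar ⟨y, μ⟩ : Matrix.specialUnitaryGroup (Fin N) ℂ) : Matrix (Fin N) (Fin N) ℂ) - D Y' ⟨y, κ⟩‖ ≤ β)
    (y : Site P l) (w : List (Letter P.d)) (κ : Fin P.d) :
    ‖((holAt Ubar (walk y w) : Matrix.specialUnitaryGroup (Fin N) ℂ) : Matrix (Fin N) (Fin N) ℂ) * D X₀ ⟨walkEnd y w, κ⟩ *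
        star ((holAt Ubar (walk y w) : Matrix.specialUnitaryGroup (Fin N) ℂ) : Matrix (Fin N) (Fin N) ℂ) - D X₀ ⟨y, κ⟩‖ ≤ (w.length : ℝ) * (β + Λ * (ℓ * c₀)) :=
  wordOsc_of_step Ubar (D X₀) (fun y' μ κ' => step_of_compositeLetters_lie Ubar D X₀ hDlin hD hDcov y' μ κ') y w κ

/-- ★★ **THE WORD-OSCILLATION OF THE LEVEL-`l` DATUM**, 𝔰𝔲(N)-valued inputs (✓p840162 §2 verbatim). [cite: Balaban1985Averaging, Prop. 4 (128)-(131) pp.37-38] -/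
theorem wordOsc_datum_of_compositeLetters_lie (Ubar : GaugeField P l (Matrix.specialUnitaryGroup (Fin N) ℂ))
    (D : (PBond P j → (specialUnitaryLogChart (Fin N)).lie) → (PBond P l → Matrix (Fin N) (Fin N) ℂ)) (X₀ : PBond P j → (specialUnitaryLogChart (Fin N)).lie)
    (Xl : PBond P l → Matrix (Fin N) (Fin N) ℂ) {Λ β ℓ c₀ ρ₂ : ℝ}
    (hDlin : ∀ Y Y' : PBond P j → (specialUnitaryLogChart (Fin N)).lie, D (fun b => Y b - Y' b) = fun c => D Y c - D Y' c)
    (hD : ∀ (Y : PBond P j → (specialUnitaryLogChart (Fin N)).lie) (s : ℝ), (∀ b, ‖((Y b : (specialUnitaryLogChart (Fin N)).lie) : Matrix (Fin N) (Fin N) ℂ)‖ ≤ s) → ∀ c, ‖D Y c‖ ≤ Λ * s)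
    (hDcov : ∀ (y : Site P l) (μ : Fin P.d), ∃ Y' : PBond P j → (specialUnitaryLogChart (Fin N)).lie, (∀ b, ‖((Y' b : (specialUnitaryLogChart (Fin N)).lie) : Matrix (Fin N) (Fin N) ℂ) - ((X₀ b : (specialUnitaryLogChart (Fin N)).lie) : Matrix (Fin N) (Fin N) ℂ)‖ ≤ ℓ * c₀) ∧
      ∀ κ : Fin P.d, ‖((Ubar ⟨y, μ⟩ : Matrix.specialUnitaryGroup (Fin N) ℂ) : Matrix (Fin N) (Fin N) ℂ) * D X₀ ⟨y.shift μ, κ⟩ *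
          star ((Ubar ⟨y, μ⟩ : Matrix.specialUnitaryGroup (Fin N) ℂ) : Matrix (Fin N) (Fin N) ℂ) - D Y' ⟨y, κ⟩‖ ≤ β)
    (hNL : ∀ c, ‖Xl c - D X₀ c‖ ≤ ρ₂)
    (y : Site P l) (w : List (Letter P.d)) (κ : Fin P.d) :
    ‖((holAt Ubar (walk y w) : Matrix.specialUnitaryGroup (Fin N) ℂ) : Matrix (Fin N) (Fin N) ℂ) * Xl ⟨walkEnd y w, κ⟩ *
        star ((holAt Ubar (walk y w) : Matrix.specialUnitaryGroup (Fin N) ℂ) : Matrix (Fin N) (Fin N) ℂ) - Xl ⟨y, κ⟩‖ ≤ (w.length : ℝ) * ((β + Λ * (ℓ * c₀)) + 2 * ρ₂) :=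
  wordOsc_of_approx Ubar Xl (D X₀) (wordOsc_of_compositeLetters_lie Ubar D X₀ hDlin hD hDcov) hNL y w κ

/-- ★★★ **(REG-UP)′ IN C₇b's CURRENCY, 𝔰𝔲(N)-VALUED INPUTS** (✓p840162 §3 verbatim): C₇b's covariant oscillation letter at level `l` with `O = 2·(d·(3L))·(β + Λ·(ℓ·c₀) + 2ρ₂)`.
[cite: Balaban1985Averaging, (8)-(9) p.18, (22) p.21, Prop. 4 (128)-(135) pp.37-38; Balaban1987RG1, (0.3)-(0.4) pp.252-253] -/
theorem hOSC_of_compositeLetters_lie (hl : l + 1 ≤ P.m + P.K) (hl2 : l + 2 ≤ P.m + P.K) (Ubar : GaugeField P l (Matrix.specialUnitaryGroup (Fin N) ℂ))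
    (D : (PBond P j → (specialUnitaryLogChart (Fin N)).lie) → (PBond P l → Matrix (Fin N) (Fin N) ℂ)) (X₀ : PBond P j → (specialUnitaryLogChart (Fin N)).lie)
    (Xl : PBond P l → (specialUnitaryLogChart (Fin N)).lie) {Λ β ℓ c₀ ρ₂ : ℝ} (hpos : 0 ≤ (β + Λ * (ℓ * c₀)) + 2 * ρ₂)
    (hDlin : ∀ Y Y' : PBond P j → (specialUnitaryLogChart (Fin N)).lie, D (fun b => Y b - Y' b) = fun c => D Y c - D Y' c)
    (hD : ∀ (Y : PBond P j → (specialUnitaryLogChart (Fin N)).lie) (s : ℝ), (∀ b, ‖((Y b : (specialUnitaryLogChart (Fin N)).lie) : Matrix (Fin N) (Fin N) ℂ)‖ ≤ s) → ∀ c, ‖D Y c‖ ≤ Λ * s)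
    (hDcov : ∀ (y : Site P l) (μ : Fin P.d), ∃ Y' : PBond P j → (specialUnitaryLogChart (Fin N)).lie, (∀ b, ‖((Y' b : (specialUnitaryLogChart (Fin N)).lie) : Matrix (Fin N) (Fin N) ℂ) - ((X₀ b : (specialUnitaryLogChart (Fin N)).lie) : Matrix (Fin N) (Fin N) ℂ)‖ ≤ ℓ * c₀) ∧
      ∀ κ : Fin P.d, ‖((Ubar ⟨y, μ⟩ : Matrix.specialUnitaryGroup (Fin N) ℂ) : Matrix (Fin N) (Fin N) ℂ) * D X₀ ⟨y.shift μ, κ⟩ *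
          star ((Ubar ⟨y, μ⟩ : Matrix.specialUnitaryGroup (Fin N) ℂ) : Matrix (Fin N) (Fin N) ℂ) - D Y' ⟨y, κ⟩‖ ≤ β)
    (hNL : ∀ c, ‖((Xl c : (specialUnitaryLogChart (Fin N)).lie) : Matrix (Fin N) (Fin N) ℂ) - D X₀ c‖ ≤ ρ₂)
    {μ ν : Fin P.d} (y' : Site P (l + 1)) (b b' : PBond P l)
    (hb : blockOf b.src = y' ∨ blockOf b.src = y'.shift μ ∨ blockOf b.src = y'.shift ν ∨ blockOf b.src = (y'.shift μ).shift ν)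
    (hb' : blockOf b'.src = y' ∨ blockOf b'.src = y'.shift μ ∨ blockOf b'.src = y'.shift ν ∨ blockOf b'.src = (y'.shift μ).shift ν)
    (hdir : b.dir = b'.dir) :
    ‖(((axialGauge Ubar (fun κ : Fin P.d => (((emb y' κ).val : ℕ) : ℤ) - (((P.L - 1) / 2 : ℕ) : ℤ)) (fun κ : Fin P.d => (((emb y' κ).val : ℕ) : ℤ) + (((if κ = μ then (P.L : ℤ) else 0) + (if κ = ν then (P.L : ℤ) else 0)) + (((P.L - 1) / 2 : ℕ) : ℤ)) + 1) b.src : Matrix.specialUnitaryGroup (Fin N) ℂ)) : Matrix (Fin N) (Fin N) ℂ) * ((Xl b : (specialUnitaryLogChart (Fin N)).lie) : Matrix (Fin N) (Fin N) ℂ) * star (((axialGauge Ubar (fun κ : Fin P.d => (((emb y' κ).val : ℕ) : ℤ) - (((P.L - 1) / 2 : ℕ) : ℤ)) (fun κ : Fin P.d => (((emb y' κ).val : ℕ) : ℤ) + (((if κ = μ then (P.L : ℤ) else 0) + (if κ = ν then (P.L : ℤ) else 0)) + (((P.L - 1) / 2 : ℕ) : ℤ)) + 1) b.src : Matrix.specialUnitaryGroup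 (Fin N) ℂ)) : Matrix (Fin N) (Fin N) ℂ) -
      (((axialGauge Ubar (fun κ : Fin P.d => (((emb y' κ).val : ℕ) : ℤ) - (((P.L - 1) / 2 : ℕ) : ℤ)) (fun κ : Fin P.d => (((emb y' κ).val : ℕ) : ℤ) + (((if κ = μ then (P.L : ℤ) else 0) + (if κ = ν then (P.L : ℤ) else 0)) + (((P.L - 1) / 2 : ℕ) : ℤ)) + 1) b'.src : Matrix.specialUnitaryGroup (Fin N) ℂ)) : Matrix (Fin N) (Fin N) ℂ) * ((Xl b' : (specialUnitaryLogChart (Fin N)).lie) : Matrix (Fin N) (Fin N) ℂ) * star (((axialGauge Ubar (fun κ : Fin P.d => (((emb y' κ).val : ℕ) : ℤ) - (((P.L - 1) / 2 : ℕ) : ℤ)) (fun κ : Fin P.d => (((emb y' κ).val : ℕ) : ℤ) + (((if κ = μ then (P.L : ℤ) else 0) + (if κ = ν then (P.L : ℤ) else 0)) + (((P.L - 1) / 2 : ℕ) : ℤ)) + 1) b'.src : Matrix.specialUnitaryGroup (Fin N) ℂ)) : Matrix (Fin N) (Fin N) ℂ)‖ ≤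
      2 * ((P.d : ℝ) * ((3 * P.L : ℕ) : ℝ)) * ((β + Λ * (ℓ * c₀)) + 2 * ρ₂) := by
  have hw := wordOsc_datum_of_compositeLetters_lie Ubar D X₀ (fun c => ((Xl c : (specialUnitaryLogChart (Fin N)).lie) : Matrix (Fin N) (Fin N) ℂ)) hDlin hD hDcov hNL
  have hz := zdWordOsc_of_torusWordOsc Ubar (fun c => ((Xl c : (specialUnitaryLogChart (Fin N)).lie) : Matrix (Fin N) (Fin N) ℂ)) hw
  exact hOSC_of_wordOscillation hl hl2 Ubar (fun c => ((Xl c : (specialUnitaryLogChart (Fin N)).lie) : Matrix (Fin N) (Fin N) ℂ)) hpos hz y' b b' hb hb' hdir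

end Summit.QuantumFields.YangMills.Theorems.FluctuationComparisonRegPrIntLS2BetaCovariantOscillationKUniformLie

end
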